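import Summits.BirchSwinnertonDyer.BirchSwinnertonDyer.Theorems.SmallImageMuTransferMuTransferX9KolyvaginClassTwist
import Summits.BirchSwinnertonDyer.BirchSwinnertonDyer.Theorems.SmallImageMuTransferMuTransferX9TwistFixedAbelian
import Summits.BirchSwinnertonDyer.BirchSwinnertonDyer.Theorems.SmallImageMuTransferMuTransferX9LocalTwistOperator
import Summits.BirchSwinnertonDyer.Rank1Residual.GaloisImage.CyclotomicLevelInertiaGenerators
import Literature.NumberTheory.EllipticCurves.ZpExtensionUnramifiedProofs
import Literature.NumberTheory.GaloisRepresentations.RestrictedRamification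
import HarnessLib

/-!
# K6 crux `MuTransferX9` (stmt-BirchSwinnertonDyer-19276), skeleton v5 stub `stub_stepsTwoFourX9`:
# MU-TRANSFER-PROOF §3 LEMMA 2 over `ℚ` — the Kolyvagin cocycle of a twisted class over
# `ℚ(μ_ℓ)` at a tame prime `ℓ ≡ 1 (mod p)`, with the generic hypotheses of
# `KolyvaginTwist.exists_kolyvaginCocycle` DISCHARGED for `G = Γ_ℚ`, `N = Gal(ℚ̄/ℚ(μ_ℓ))`,
# `X = 𝒯_J = M ⊗ 𝔽_p[T]/T^J(χ_κ)` (`ZpExtension.twistModP`)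

Cell `bsd-smallim`, seat `bsd-smallim-k6-g3` (gen 0).  THEOREMS ONLY (no definition, no named fact,
no `sorry`).  HONEST FRAMING: helper toward the registered stub `stub_stepsTwoFourX9` (the Λ-adic
Kolyvagin class `κ_q`); closes nothing.  PARTITION (D-0054): X9 (A4) — helper; closes NONE.

Sequel of `…X9KolyvaginClassTwist.lean` (generic single-prime Kolyvagin class).  Here the data are
those of MU-TRANSFER-PROOF §2–§3: a prime `p`, a `ℤ_p`-extension `κ` of `ℚ`, a discrete
`Γ_ℚ`-module `ρ` on `M` killed by `p` WITHOUT non-zero vectors fixed by `Gal(ℚ̄/ℚ(μ_ℓ))` ((F1):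
for `M = E[p]`, `E[p]` irreducible, `p ≠ 2`, x9's `TwistFixed.modPTwist_eq_zero_of_forall_apply_eq_of_commutator_le`
/ the tree's `geomTorsion_eq_zero_of_fixed_of_commutator_le`, since `ℚ(μ_ℓ)` is abelian), the
coefficient module `X = 𝒯_J := κ.twistModP ρ hM J`, a finite place `q` of `ℚ` with rational prime
`ℓ ≠ p`, `ρ` unramified at `q`, `p ∣ ℓ − 1` (automatic at an `E`-split prime, x9 p450982), and a
prime `𝔔 ∣ q` of `ℤ̄`.  The discharges:

* `twistModP_apply_eq_self_of_mem_inertia` — **`ℐ_𝔔` acts trivially on `𝒯_J`** (`ρ` unramified at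
  `q`; `κ` unramified outside `p`: tree `ZpExtension.inertia_le_kerSubgroup_holds`, Washington 13.2);
* `twistModP_eq_zero_of_forall_rootsOfUnityFixer` — **`𝒯_J^{Gal(ℚ̄/ℚ(μ_ℓ))} = 0`** from the same
  for `M` (x9's generic `TwistFixed.twistModP_eq_zero_of_forall_apply_eq`);
* `exists_generator_mem_inertia` — **a tame generator `σ ∈ ℐ_𝔔`**: `χ_ℓ(σ)` generates `(ℤ/ℓ)ˣ`,
  so `σ^{ℓ−1} ∈ N := Gal(ℚ̄/ℚ(μ_ℓ))` and the `σ^i`, `i < ℓ − 1`, represent `Γ_ℚ/N` exactly once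
  (b2b `CyclotomicLevel.Rat.exists_mem_inertia_modNCyclotomicCharacter_eq_of_mem_primesAbove`,
  `existsUnique_pow_inv_mul_mem_rootsOfUnityFixer`);
* `sum_range_natCast_zsmul_eq_zero` — `(Σ_{i<ℓ−1} i) • x = 0` on `𝒯_J` (`p` odd, `p ∣ ℓ − 1`:
  the memo's "`C(n,2) ≡ 0`");
* **`exists_kolyvaginCocycle_rat`** — for a cocycle `y` of `N` with values in `𝒯_J`, UNRAMIFIED at
  `𝔔` (`res_{N ⊓ ℐ_𝔔}[y] = 0`) and with VANISHING NORM `res (cor [y]) = 0` (the Euler-system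
  relation reduced modulo `T^J`), there are such a `σ` and a global cocycle `Φ` with
  `Φ|_N = Σ i•σ^i·y`, `Φ(σ) = −a` for EVERY norm witness `a` (and one exists), `res[Φ] = Σ i•σ^i·[y]`
  with `[Φ]` unique, `Φ = 0` on `N ∩ ℐ_𝔔`, and `Φ(φ) = 0` at every `φ ∈ N` normalising `ℐ_𝔔`
  (a Frobenius at `𝔔` chosen in `G_K`): MU-TRANSFER-PROOF Lemma 2's `κ_q`, "unramified … transverse
  at `q` … `κ̃(σ) = −t_N`, `κ̃(Fr) = 0`, `κ̃|_{ℐ∩H} = 0`", up to (a) the production of `y` (G3a) and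
  (b) the division step (`…X9KolyvaginValueDivision`).

References: HOME/koly/MU-TRANSFER-PROOF.md §§2–3; K. Rubin, *Euler Systems* (2000) §4.4
[Rubin2000]; B. Perrin-Riou, Ann. Inst. Fourier 48 (1998) §3.1.2 [PerrinRiou1998AIF];
L. Washington, *Introduction to Cyclotomic Fields* (1997) Prop. 13.2, §13.2 [Washington1997].
-/

-- the summit and its single problem are both named `BirchSwinnertonDyer` (registry layout D-0017)
set_option linter.dupNamespace false
set_option autoImplicit false

noncomputable section

open CategoryTheory Function Finset
open scoped NumberField Pointwise
open Field IsDedekindDomain NumberField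
open Literature.NumberTheory.GaloisRepresentations
open Literature.NumberTheory.EllipticCurves
open Literature.NumberTheory.EllipticCurves.ZpExtension
open Rat.HeightOneSpectrum
open Summit.BirchSwinnertonDyer.Rank1Residual.GaloisImage
open Summit.BirchSwinnertonDyer.Rank1Residual.GaloisImage.Derivative
open Summit.BirchSwinnertonDyer.Rank1Residual.GaloisImage.CyclotomicLevel.Rat
open Summit.BirchSwinnertonDyer.BirchSwinnertonDyer.Rank1Residual

namespace Summit.BirchSwinnertonDyer.BirchSwinnertonDyer.Rank1Residual.KolyvaginTwist

variable {p : ℕ} [Fact p.Prime] {M : Type} [AddCommGroup M] [TopologicalSpace M]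
  [DiscreteTopology M] (κ : ZpExtension ℚ p) (ρ : DiscreteGaloisModule ℚ M)
  (hM : ∀ m : M, p • m = 0) (J : ℕ)

/-! ### §1 The action of `Γ_ℚ` on `𝒯_J` as a `TopRep`, inertia, fixed vectors -/

/-- Unfolding: the `TopRep` action of `𝒯_J` is `κ.twistModP`. [folklore]-style plumbing for the
b2b/KolyvaginTwist lemmas stated on `X : TopRep`. [cite: Washington1997, §13.1–§13.2] -/
theorem toTopRep_twistModP_ρ_apply (g : absoluteGaloisGroup ℚ) (x : Fin J → M) :
    (κ.twistModP ρ hM J).toTopRep.ρ g x = κ.twistModP ρ hM J g x := rfl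

/-- **The inertia group at `𝔔 ∣ q`, `q ∤ p`, acts trivially on `𝒯_J`** when `ρ` is unramified at
`q`: `ρ(ℐ_𝔔) = 1` and `κ(ℐ_𝔔) = 1` (a `ℤ_p`-extension is unramified outside `p`, tree
`inertia_le_kerSubgroup_holds`), so the twist exponent is `0`.  MU-TRANSFER-PROOF §2: "`ρ_𝒯(ℐ) = 1`".
[cite: Washington1997, Prop. 13.2] -/
theorem twistModP_apply_eq_self_of_mem_inertia {q : HeightOneSpectrum (𝓞 ℚ)}
    (hpq : (p : 𝓞 ℚ) ∉ q.asIdeal) (hunr : GaloisRep.IsUnramifiedAt q ρ)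
    {𝔔 : Ideal (absIntegers (𝓞 ℚ) ℚ)} (h𝔔 : 𝔔 ∈ q.primesAbove)
    {g : absoluteGaloisGroup ℚ} (hg : g ∈ 𝔔.inertia (absoluteGaloisGroup ℚ)) (x : Fin J → M) :
    κ.twistModP ρ hM J g x = x := by
  have hρ : ρ g = 1 := hunr 𝔔 h𝔔 g hg
  have hκ : κ g = 1 := ZpExtension.mem_kerSubgroup.mp
    (ZpExtension.inertia_le_kerSubgroup_holds ℚ p κ hpq h𝔔 hg)
  rw [twistModP_apply, LocalSplitPrime.twistExponent_eq_zero_of_apply_eq_one κ J hκ,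
    unipotentPow_zero, Module.End.one_apply]
  funext i
  rw [hρ]
  rfl

/-- **`𝒯_J` has no non-zero vector fixed by `N = Gal(ℚ̄/ℚ(μ_ℓ))`** as soon as `M` has none (x9's
`TwistFixed.twistModP_eq_zero_of_forall_apply_eq`, induction on `J`), in the `TopRep` form `h0`
consumed by `KolyvaginTwist.exists_kolyvaginCocycle`. [cite: Rubin2000, Lemma 4.4.2] -/
theorem twistModP_eq_zero_of_forall_rootsOfUnityFixer (ℓ : ℕ)
    (hfix : ∀ m : M, (∀ g ∈ rootsOfUnityFixer ℚ ℓ, ρ g m = m) → m = 0)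
    (v : (κ.twistModP ρ hM J).toTopRep)
    (hv : ∀ u : rootsOfUnityFixer ℚ ℓ,
      (κ.twistModP ρ hM J).toTopRep.ρ (u : absoluteGaloisGroup ℚ) v = v) : v = 0 :=
  TwistFixed.twistModP_eq_zero_of_forall_apply_eq κ ρ hM (rootsOfUnityFixer ℚ ℓ) hfix J v
    fun g hg => hv ⟨g, hg⟩

/-- `Gal(ℚ̄/ℚ(μ_ℓ))` is normal in `Γ_ℚ` (`ℚ(μ_ℓ)/ℚ` is abelian: it contains the commutator
subgroup). [cite: Washington1997, §13.1–§13.2] -/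
theorem normal_rootsOfUnityFixer (ℓ : ℕ) [NeZero ℓ] : (rootsOfUnityFixer ℚ ℓ).Normal :=
  Subgroup.Normal.of_commutator_le _ (commutator_le_rootsOfUnityFixer ℚ ℓ)

/-! ### §2 The tame generator `σ ∈ ℐ_𝔔` -/

/-- **A tame generator inside the inertia group.**  For a finite place `q` of `ℚ` with rational
prime `ℓ` and `𝔔 ∣ q` a prime of `ℤ̄`, there is `σ ∈ ℐ_𝔔` whose mod-`ℓ` cyclotomic character
GENERATES `(ℤ/ℓ)ˣ` (`ℚ(μ_ℓ)/ℚ` totally ramified at `ℓ`); consequently `σ^{ℓ−1} ∈ N`, every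
`g ∈ Γ_ℚ` has a unique `i < ℓ − 1` with `(σ^i)⁻¹ g ∈ N`, `N = Gal(ℚ̄/ℚ(μ_ℓ))` — the binders
`hσn` / `hcov` / `hinj` of the Kolyvagin descent (MU-TRANSFER-PROOF §2: "`ℐ ↠ Γ_q = Gal(K/ℚ) = ⟨σ̄⟩`,
`σ ∈ ℐ` over `σ̄`"). [cite: Rubin2000, §4.4 (the choice of σ_ℓ)] -/
theorem exists_generator_mem_inertia (q : HeightOneSpectrum (𝓞 ℚ))
    {𝔔 : Ideal (absIntegers (𝓞 ℚ) ℚ)} (h𝔔 : 𝔔 ∈ q.primesAbove) :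
    ∃ σ ∈ 𝔔.inertia (absoluteGaloisGroup ℚ),
      σ ^ (((primesEquiv q : Nat.Primes) : ℕ) - 1) ∈
          rootsOfUnityFixer ℚ ((primesEquiv q : Nat.Primes) : ℕ) ∧
      (∀ g : absoluteGaloisGroup ℚ, ∃ i < ((primesEquiv q : Nat.Primes) : ℕ) - 1,
        (σ ^ i)⁻¹ * g ∈ rootsOfUnityFixer ℚ ((primesEquiv q : Nat.Primes) : ℕ)) ∧
      (∀ i₁ < ((primesEquiv q : Nat.Primes) : ℕ) - 1, ∀ i₂ < ((primesEquiv q : Nat.Primes) : ℕ) - 1,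
        (σ ^ i₁)⁻¹ * σ ^ i₂ ∈ rootsOfUnityFixer ℚ ((primesEquiv q : Nat.Primes) : ℕ) → i₁ = i₂) := by
  set ℓ : ℕ := ((primesEquiv q : Nat.Primes) : ℕ) with hℓ
  have hℓp : ℓ.Prime := (primesEquiv q).2
  haveI : Fact ℓ.Prime := ⟨hℓp⟩
  haveI : NeZero ℓ := ⟨hℓp.ne_zero⟩
  obtain ⟨η, hη⟩ := IsCyclic.exists_generator (α := (ZMod ℓ)ˣ)
  obtain ⟨σ, hσI, hσχ⟩ := exists_mem_inertia_modNCyclotomicCharacter_eq_of_mem_primesAbove q h𝔔 η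
  have hgen : ∀ x : (ZMod ℓ)ˣ, x ∈ Subgroup.zpowers (modNCyclotomicCharacter ℚ ℓ σ) := by
    intro x; rw [hσχ]; exact hη x
  have hcard : Nat.card (ZMod ℓ)ˣ = ℓ - 1 := natCard_units_zmod_eq_sub_one hℓp
  refine ⟨σ, hσI, ?_, fun g => ?_, fun i₁ hi₁ i₂ hi₂ h => ?_⟩
  · -- `χ_ℓ(σ^{ℓ-1}) = χ_ℓ(σ)^{#(ℤ/ℓ)ˣ} = 1`
    rw [rootsOfUnityFixer_eq_ker, MonoidHom.mem_ker, map_pow, ← hcard, pow_card_eq_one']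
  · obtain ⟨i, ⟨hi, hig⟩, -⟩ := existsUnique_pow_inv_mul_mem_rootsOfUnityFixer σ hgen g
    exact ⟨i, hcard ▸ hi, hig⟩
  · have h₂ : (σ ^ i₂)⁻¹ * σ ^ i₂ ∈ rootsOfUnityFixer ℚ ℓ := by
      rw [inv_mul_cancel]; exact one_mem _
    rw [← hcard] at hi₁ hi₂
    exact (existsUnique_pow_inv_mul_mem_rootsOfUnityFixer σ hgen (σ ^ i₂)).unique ⟨hi₁, h⟩ ⟨hi₂, h₂⟩

/-- The commutator-type elements `φ⁻¹ (σ^i)⁻¹ φ σ^i` of MU-TRANSFER-PROOF §3 ("`σ^{-j}Frσ^j = τ_jFr`,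
`τ_j ∈ ℐ ∩ H`") are inertial as soon as `φ` NORMALISES `ℐ_𝔔` (e.g. `φ` in the decomposition
group of `𝔔`: `φ⁻¹ ℐ_𝔔 φ = ℐ_{φ⁻¹•𝔔} = ℐ_𝔔`, tree `conj_mem_inertia_smul`) and `σ ∈ ℐ_𝔔`.
[cite: Rubin2000, §4.4] -/
theorem inv_mul_conj_mem_of_normalises {G : Type*} [Group G] (I : Subgroup G) {φ σ : G}
    (hφ : ∀ τ ∈ I, φ⁻¹ * τ * φ ∈ I) (hσ : σ ∈ I) (i : ℕ) :
    φ⁻¹ * ((σ ^ i)⁻¹ * φ * σ ^ i) ∈ I := by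
  have h1 : φ⁻¹ * (σ ^ i)⁻¹ * φ ∈ I := hφ _ (I.inv_mem (I.pow_mem hσ i))
  have h2 := I.mul_mem h1 (I.pow_mem hσ i)
  simpa only [mul_assoc] using h2

/-! ### §3 `(ℓ − 1)·𝒯_J = 0` and `C(ℓ−1, 2)·𝒯_J = 0` -/

omit [TopologicalSpace M] [DiscreteTopology M] in
/-- On a `p`-torsion module with `p` ODD, `2·w = 0` forces `w = 0` (`w = (p+1)w = ((p+1)/2)(2w)`).
[cite: Washington1997, §13.1–§13.2] -/
theorem eq_zero_of_two_nsmul_eq_zero (hMp : ∀ m : M, p • m = 0) (hp2 : p ≠ 2) {w : Fin J → M}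
    (h2 : (2 : ℕ) • w = 0) : w = 0 := by
  have hpw : p • w = 0 := by
    funext i; rw [Pi.smul_apply, Pi.zero_apply, hMp]
  have hodd : 2 ∣ p + 1 := by
    rcases (Fact.out : p.Prime).eq_two_or_odd with h | h
    · exact absurd h hp2
    · omega
  obtain ⟨c, hc⟩ := hodd
  have : (p + 1) • w = w := by rw [add_smul, hpw, one_smul, zero_add]
  rw [← this, hc, mul_comm, mul_smul, h2, smul_zero]

omit [TopologicalSpace M] [DiscreteTopology M] in
/-- **`(Σ_{i<n} i) • x = 0` on `𝒯_J`** for `p` odd and `p ∣ n` (Gauss: `2·Σ_{i<n} i = n(n−1)`,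
and `n` kills `𝒯_J`): the memo's "`C(n,2) = n(n−1)/2 ≡ 0`" making `κ̃(Fr) = C(n,2)·t_q = 0`.
[cite: PerrinRiou1998AIF, §3.1.2] -/
theorem sum_range_natCast_zsmul_eq_zero (hMp : ∀ m : M, p • m = 0) (hp2 : p ≠ 2) {n : ℕ}
    (hn : p ∣ n) (x : Fin J → M) : (∑ i ∈ range n, (i : ℤ)) • x = 0 := by
  have hnx : n • x = 0 := by
    obtain ⟨c, rfl⟩ := hn
    funext i; rw [Pi.smul_apply, Pi.zero_apply, mul_comm, mul_smul, hMp, smul_zero]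
  have h1 : (∑ i ∈ range n, (i : ℤ)) • x = (∑ i ∈ range n, i) • x := by
    rw [← Nat.cast_sum, natCast_zsmul]
  rw [h1]
  apply eq_zero_of_two_nsmul_eq_zero J hMp hp2
  rw [← mul_smul, mul_comm, Finset.sum_range_id_mul_two]
  have : (n - 1) • (n • x) = 0 := by rw [hnx, smul_zero]
  rwa [← mul_smul, Nat.mul_comm] at this

/-! ### §4 The Kolyvagin cocycle over `ℚ` -/

/-- **MU-TRANSFER-PROOF §3 LEMMA 2 over `ℚ` (up to the production of `y` and the division step).**
Data: `p` odd, `κ` a `ℤ_p`-extension of `ℚ`, `ρ` on `M` with `p·M = 0` and no non-zero vector fixed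
by `N := Gal(ℚ̄/ℚ(μ_ℓ))`, `𝒯_J = κ.twistModP ρ hM J`; a place `q` of `ℚ` with prime `ℓ`, `q ∤ p`,
`ρ` unramified at `q`, `p ∣ ℓ − 1`; a prime `𝔔 ∣ q`; an `N`-cocycle `y` with values in `𝒯_J` which is
UNRAMIFIED at `𝔔` (`res_{N ⊓ ℐ_𝔔}[y] = 0` — Kato's classes are integral, `Kato2004.integralH1`) and
whose NORM VANISHES, `res (cor [y]) = 0` (the norm relation `cor 𝐳̄_q = P·𝐳̄_1` modulo `T^J`,
`P ∈ T^{2e}Ω`, `J ≤ 2e`).  Conclusion: a tame generator `σ ∈ ℐ_𝔔` (`σ^{ℓ−1} ∈ N`, powers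
representing `Γ_ℚ/N`) and a GLOBAL continuous cocycle `Φ : Γ_ℚ → 𝒯_J` — a cocycle of the Kolyvagin
class `κ_q` — with: `Φ|_N = Σ_{i<ℓ−1} i•σ^i·y`; a norm witness exists and `Φ(σ) = −a` for every
norm witness `a` (`κ̃(σ) = −t_N`); `res[Φ] = Σ i•σ^i·[y]` and `[Φ]` is the unique such class;
`Φ` vanishes on `N ∩ ℐ_𝔔` and at every `φ ∈ N` normalising `ℐ_𝔔` (`κ̃|_{ℐ∩H} = 0`, `κ̃(Fr) = 0`:
transversality at `q`). [cite: PerrinRiou1998AIF, §3.1.2] [cite: Rubin2000, Def. 4.4.4 and Lemma 4.4.2] -/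
theorem exists_kolyvaginCocycle_rat (hp2 : p ≠ 2) (q : HeightOneSpectrum (𝓞 ℚ))
    [NeZero ((primesEquiv q : Nat.Primes) : ℕ)]
    [hNn : (rootsOfUnityFixer ℚ ((primesEquiv q : Nat.Primes) : ℕ)).Normal]
    [Fintype (absoluteGaloisGroup ℚ ⧸ rootsOfUnityFixer ℚ ((primesEquiv q : Nat.Primes) : ℕ))]
    (hfix : ∀ m : M,
      (∀ g ∈ rootsOfUnityFixer ℚ ((primesEquiv q : Nat.Primes) : ℕ), ρ g m = m) → m = 0)
    (hpq : (p : 𝓞 ℚ) ∉ q.asIdeal) (hunr : GaloisRep.IsUnramifiedAt q ρ)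
    (hdvd : p ∣ ((primesEquiv q : Nat.Primes) : ℕ) - 1)
    {𝔔 : Ideal (absIntegers (𝓞 ℚ) ℚ)} (h𝔔 : 𝔔 ∈ q.primesAbove)
    (y : contOneCocycles (subgroupRep (κ.twistModP ρ hM J).toTopRep
      (rootsOfUnityFixer ℚ ((primesEquiv q : Nat.Primes) : ℕ))))
    (hyI : resLe (κ.twistModP ρ hM J).toTopRep
      (inf_le_left : rootsOfUnityFixer ℚ ((primesEquiv q : Nat.Primes) : ℕ) ⊓
        𝔔.inertia (absoluteGaloisGroup ℚ) ≤ _) 1 (oneCocycleClass _ y) = 0)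
    (h𝒩 : resSubgroup (κ.twistModP ρ hM J).toTopRep
        (rootsOfUnityFixer ℚ ((primesEquiv q : Nat.Primes) : ℕ)) 1
      (cores (κ.twistModP ρ hM J).toTopRep (rootsOfUnityFixer ℚ ((primesEquiv q : Nat.Primes) : ℕ))
        (isOpen_rootsOfUnityFixer ℚ _) (oneCocycleClass _ y)) = 0) :
    ∃ σ ∈ 𝔔.inertia (absoluteGaloisGroup ℚ),
      σ ^ (((primesEquiv q : Nat.Primes) : ℕ) - 1) ∈
          rootsOfUnityFixer ℚ ((primesEquiv q : Nat.Primes) : ℕ) ∧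
      (∀ g : absoluteGaloisGroup ℚ, ∃ i < ((primesEquiv q : Nat.Primes) : ℕ) - 1,
        (σ ^ i)⁻¹ * g ∈ rootsOfUnityFixer ℚ ((primesEquiv q : Nat.Primes) : ℕ)) ∧
      (∀ x : Fin J → M, κ.twistModP ρ hM J σ x = x) ∧
      ∃ Φ : contOneCocycles (κ.twistModP ρ hM J).toTopRep,
        (∀ u : rootsOfUnityFixer ℚ ((primesEquiv q : Nat.Primes) : ℕ),
          Φ.1 u = ∑ i ∈ range (((primesEquiv q : Nat.Primes) : ℕ) - 1),
            (i : ℤ) • (κ.twistModP ρ hM J).toTopRep.ρ (σ ^ i) (y.1 (subgroupConj _ (σ ^ i) u))) ∧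
        (∃ a : Fin J → M, ∀ u : rootsOfUnityFixer ℚ ((primesEquiv q : Nat.Primes) : ℕ),
          ∑ i ∈ range (((primesEquiv q : Nat.Primes) : ℕ) - 1),
            (κ.twistModP ρ hM J).toTopRep.ρ (σ ^ i) (y.1 (subgroupConj _ (σ ^ i) u)) =
            (κ.twistModP ρ hM J).toTopRep.ρ (u : absoluteGaloisGroup ℚ) a - a) ∧
        (∀ a : Fin J → M, (∀ u : rootsOfUnityFixer ℚ ((primesEquiv q : Nat.Primes) : ℕ),
          ∑ i ∈ range (((primesEquiv q : Nat.Primes) : ℕ) - 1),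
            (κ.twistModP ρ hM J).toTopRep.ρ (σ ^ i) (y.1 (subgroupConj _ (σ ^ i) u)) =
            (κ.twistModP ρ hM J).toTopRep.ρ (u : absoluteGaloisGroup ℚ) a - a) → Φ.1 σ = -a) ∧
        resSubgroup (κ.twistModP ρ hM J).toTopRep
            (rootsOfUnityFixer ℚ ((primesEquiv q : Nat.Primes) : ℕ)) 1 (oneCocycleClass _ Φ) =
          ∑ i ∈ range (((primesEquiv q : Nat.Primes) : ℕ) - 1),
            i • conjMap (κ.twistModP ρ hM J).toTopRep
              (rootsOfUnityFixer ℚ ((primesEquiv q : Nat.Primes) : ℕ)) (σ ^ i) 1 (oneCocycleClass _ y) ∧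
        (∀ κ' : continuousCohomology 1 (κ.twistModP ρ hM J).toTopRep,
          resSubgroup (κ.twistModP ρ hM J).toTopRep
              (rootsOfUnityFixer ℚ ((primesEquiv q : Nat.Primes) : ℕ)) 1 κ' =
            ∑ i ∈ range (((primesEquiv q : Nat.Primes) : ℕ) - 1),
              i • conjMap (κ.twistModP ρ hM J).toTopRep
                (rootsOfUnityFixer ℚ ((primesEquiv q : Nat.Primes) : ℕ)) (σ ^ i) 1 (oneCocycleClass _ y) →
          κ' = oneCocycleClass _ Φ) ∧
        (∀ τ ∈ 𝔔.inertia (absoluteGaloisGroup ℚ),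
          τ ∈ rootsOfUnityFixer ℚ ((primesEquiv q : Nat.Primes) : ℕ) → Φ.1 τ = 0) ∧
        (∀ φ ∈ rootsOfUnityFixer ℚ ((primesEquiv q : Nat.Primes) : ℕ),
          (∀ τ ∈ 𝔔.inertia (absoluteGaloisGroup ℚ), φ⁻¹ * τ * φ ∈ 𝔔.inertia (absoluteGaloisGroup ℚ)) →
            Φ.1 φ = 0) := by
  -- the generator
  obtain ⟨σ, hσI, hσn, hcov, hinj⟩ := exists_generator_mem_inertia q h𝔔
  -- inertia acts trivially
  have hI : ∀ τ ∈ 𝔔.inertia (absoluteGaloisGroup ℚ), ∀ w : Fin J → M,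
      (κ.twistModP ρ hM J).toTopRep.ρ τ w = w := fun τ hτ w =>
    twistModP_apply_eq_self_of_mem_inertia κ ρ hM J hpq hunr h𝔔 hτ w
  have hσ : ∀ w : Fin J → M, (κ.twistModP ρ hM J).toTopRep.ρ σ w = w := hI σ hσI
  -- `X^N = 0`
  have h0 := twistModP_eq_zero_of_forall_rootsOfUnityFixer κ ρ hM J _ hfix
  -- `(ℓ - 1) • X = 0`
  have hnX : ∀ w : Fin J → M, ((((primesEquiv q : Nat.Primes) : ℕ) - 1 : ℕ) : ℤ) • w = 0 :=
    fun w => by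
    rw [natCast_zsmul]; exact LocalSplitPrime.sub_one_smul_eq_zero_of_dvd hM hdvd w
  -- `y` vanishes on `N ∩ ℐ_𝔔`
  have hyτ := apply_eq_zero_of_resLe_inf_eq_zero _ _ (𝔔.inertia (absoluteGaloisGroup ℚ)) hI y hyI
  have hyσn : y.1 ⟨σ ^ (((primesEquiv q : Nat.Primes) : ℕ) - 1), hσn⟩ = 0 :=
    hyτ ⟨_, hσn⟩ (Subgroup.pow_mem _ hσI _)
  -- the norm witness from `res (cor [y]) = 0`
  have h𝒩' : ∑ i ∈ range (((primesEquiv q : Nat.Primes) : ℕ) - 1),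
      conjMap (κ.twistModP ρ hM J).toTopRep (rootsOfUnityFixer ℚ ((primesEquiv q : Nat.Primes) : ℕ))
        (σ ^ i) 1 (oneCocycleClass _ y) = 0 := by
    rw [sum_conjMap_pow_eq_resSubgroup_cores _ _ (isOpen_rootsOfUnityFixer ℚ _) hcov hinj]
    exact h𝒩
  obtain ⟨a₀, ha₀⟩ := exists_norm_witness_of_sum_conjMap_eq_zero _ _ σ _ y h𝒩'
  have hgen : ∀ g : absoluteGaloisGroup ℚ, ∃ i : ℕ,
      (σ ^ i)⁻¹ * g ∈ rootsOfUnityFixer ℚ ((primesEquiv q : Nat.Primes) : ℕ) := fun g => by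
    obtain ⟨i, -, hi⟩ := hcov g; exact ⟨i, hi⟩
  obtain ⟨Φ, hΦN, -, hres, huniq⟩ := exists_kolyvaginCocycle _ _ (isOpen_rootsOfUnityFixer ℚ _)
    h0 hσ hσn hgen hnX y hyσn a₀ ha₀
  refine ⟨σ, hσI, hσn, hcov, hσ, Φ, hΦN, ⟨a₀, ha₀⟩, fun a ha => ?_, hres, huniq,
    fun τ hτI hτN => ?_, fun φ hφN hφ => ?_⟩
  · -- every norm witness gives the value
    obtain ⟨Ψ, hΨ, -⟩ := exists_derivCocycle (κ.twistModP ρ hM J).toTopRep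
      (rootsOfUnityFixer ℚ ((primesEquiv q : Nat.Primes) : ℕ)) σ
      (((primesEquiv q : Nat.Primes) : ℕ) - 1) y
    exact apply_eq_neg_of_norm_eq_coboundary _ _ σ hσ hσn hnX h0 y a ha hyσn Ψ hΨ Φ
      fun u => by rw [hΦN, hΨ]
  · -- vanishing on `N ∩ ℐ_𝔔`
    refine derivCocycle_apply_eq_zero _ _ σ _ y Φ hΦN ⟨τ, hτN⟩ fun i => hyτ _ ?_
    rw [subgroupConj_apply_coe]
    exact Subgroup.mul_mem _ (Subgroup.mul_mem _ (Subgroup.inv_mem _ (Subgroup.pow_mem _ hσI i))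
      hτI) (Subgroup.pow_mem _ hσI i)
  · -- vanishing at a Frobenius-type element of `N` normalising `ℐ_𝔔`
    have hkill : ∀ i : ℕ, y.1 ((⟨φ, hφN⟩ : rootsOfUnityFixer ℚ ((primesEquiv q : Nat.Primes) : ℕ))⁻¹ *
        subgroupConj _ (σ ^ i) ⟨φ, hφN⟩) = 0 := fun i =>
      hyτ _ (inv_mul_conj_mem_of_normalises (𝔔.inertia (absoluteGaloisGroup ℚ)) hφ hσI i)
    rw [derivCocycle_apply_eq_sum_smul _ _ hσ _ y Φ hΦN ⟨φ, hφN⟩ hkill]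
    exact sum_range_natCast_zsmul_eq_zero J hM hp2 hdvd _

end Summit.BirchSwinnertonDyer.BirchSwinnertonDyer.Rank1Residual.KolyvaginTwist

end
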